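import Summits.CriticalPhenomena.PercolationContinuityZ3.Theorems.SahiMasterFamilyKahnModuleTensorOr
import Summits.CriticalPhenomena.PercolationContinuityZ3.Theorems.SahiMasterFamilyKahnModuleBridge

/-!
# The tensor class 𝒯 of Kahn pairs (lineage `prim-master-conj`, gen 56; `--supports stmt-CriticalPhenomena-4575`)

Setting of `…SahiMasterFamilyKahnModule{Prelim,Tensor,TensorOr,Bridge}`.  A pair `(g₂,h₂)` of functions on a weighted preorder `X₂`
**tensors well**, `TensorKahn X₂ w₂ g₂ h₂`, if for EVERY Harris probability space `X₁` and EVERY Kahn pair `(g₁,h₁)` of monotone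
indicators on `X₁` the tensor pair `(g₁⊗g₂, h₁⊗h₂) = (B₁ ∧ B₂, C₁ ∧ C₂)` is a Kahn pair on `X₁ × X₂`.  CONJECTURE T⊗ of the lineage
(memo gen 55 §3b) says that every Kahn pair tensors well; this file records the part that is PROVED:

* `tensorKahn_of_le`, `tensorKahn_of_ge` — nested pairs tensor well (THEOREM G8, `kahnPair_tensor_nested`);
* `TensorKahn.symm`; `TensorKahn.kahnPair_tensor` (the defining property);
* `TensorKahn.tensor` — 𝒯 is closed under tensor products (associativity of `×` and transport along `OrderIso.prodAssoc`): if
  `(g₂,h₂)` and `(g₃,h₃)` tensor well then so does `(g₂⊗g₃, h₂⊗h₃)`;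
* `TensorKahn.lift`, `TensorKahn.and_left`, `TensorKahn.and_right`, `TensorKahn.and_and`, `tensorKahn_and_or` — closure under the
  AND-type module steps of `…KahnModulePeelable` (all are tensor products with nested pairs on the fresh block);
* consequence `KahnPair.tensor_of_tensorKahn` restated for two and three blocks (`kahnPair_tensor₃`).

So far 𝒯 ⊇ the ⊗-closure of nested pairs, closed under the AND-module steps; the OR-steps (`or_left`, `or_or`) are open as
closure properties (memo gen 56).  Nothing here asserts T⊗ or Kahn's Conjecture 5.  [this work]
-/

open Finset
open scoped BigOperators

namespace Summit.CriticalPhenomena.PercolationContinuityZ3.Theorems.SahiKahnModule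

universe u

/-- **The tensor class 𝒯.**  `(g₂,h₂)` on `(X₂,w₂)` tensors well: for every Harris probability space `(X₁,w₁)` and every Kahn pair
`(g₁,h₁)` of monotone indicators on it, `(g₁⊗g₂, h₁⊗h₂)` is a Kahn pair on `X₁ × X₂`. [this work] -/
def TensorKahn (X₂ : Type u) [Fintype X₂] [Preorder X₂] (w₂ g₂ h₂ : X₂ → ℝ) : Prop :=
  ∀ (X₁ : Type u) [Fintype X₁] [Preorder X₁] (w₁ g₁ h₁ : X₁ → ℝ), IsProbWeight w₁ → IsHarris w₁ → IsIndicator g₁ → IsIndicator h₁ →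
    Monotone g₁ → Monotone h₁ → KahnPair w₁ g₁ h₁ → KahnPair (prodW w₁ w₂) (liftX g₁ * liftY g₂) (liftX h₁ * liftY h₂)

variable {X₂ : Type u} [Fintype X₂] [Preorder X₂] {w₂ g₂ h₂ : X₂ → ℝ}

/-- The defining property, as a lemma. [this work] -/
theorem TensorKahn.kahnPair_tensor (hT : TensorKahn X₂ w₂ g₂ h₂) {X₁ : Type u} [Fintype X₁] [Preorder X₁] {w₁ g₁ h₁ : X₁ → ℝ}
    (hw₁ : IsProbWeight w₁) (hX₁ : IsHarris w₁) (hg₁ : IsIndicator g₁) (hh₁ : IsIndicator h₁) (hg₁m : Monotone g₁)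
    (hh₁m : Monotone h₁) (hK : KahnPair w₁ g₁ h₁) :
    KahnPair (prodW w₁ w₂) (liftX g₁ * liftY g₂) (liftX h₁ * liftY h₂) :=
  hT X₁ w₁ g₁ h₁ hw₁ hX₁ hg₁ hh₁ hg₁m hh₁m hK

/-- **Nested pairs tensor well** (`g₂ ≤ h₂`; THEOREM G8 `kahnPair_tensor_nested`). [this work] -/
theorem tensorKahn_of_le (hw₂ : IsProbWeight w₂) (hH₂ : IsHarris w₂) (hg₂ : IsIndicator g₂) (hh₂ : IsIndicator h₂)
    (hg₂m : Monotone g₂) (hh₂m : Monotone h₂) (hle : ∀ y, g₂ y ≤ h₂ y) : TensorKahn X₂ w₂ g₂ h₂ :=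
  fun _ _ _ _ _ _ hw₁ hX₁ hg₁ hh₁ hg₁m hh₁m hK =>
    kahnPair_tensor_nested hw₁ hw₂ hX₁ hH₂ hg₁ hh₁ hg₁m hh₁m hg₂ hh₂ hg₂m hh₂m hle hK

/-- **Nested pairs tensor well** (`h₂ ≤ g₂`). [this work] -/
theorem tensorKahn_of_ge (hw₂ : IsProbWeight w₂) (hH₂ : IsHarris w₂) (hg₂ : IsIndicator g₂) (hh₂ : IsIndicator h₂)
    (hg₂m : Monotone g₂) (hh₂m : Monotone h₂) (hge : ∀ y, h₂ y ≤ g₂ y) : TensorKahn X₂ w₂ g₂ h₂ :=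
  fun _ _ _ _ _ _ hw₁ hX₁ hg₁ hh₁ hg₁m hh₁m hK =>
    kahnPair_tensor_nested' hw₁ hw₂ hX₁ hH₂ hg₁ hh₁ hg₁m hh₁m hh₂ hg₂ hh₂m hg₂m hge hK

/-- The trivial pair `(1,1)` tensors well (a special nested pair; this is `kahnPair_liftX` in disguise). [this work] -/
theorem tensorKahn_one_one (hw₂ : IsProbWeight w₂) (hH₂ : IsHarris w₂) : TensorKahn X₂ w₂ 1 1 :=
  tensorKahn_of_le hw₂ hH₂ (fun _ => Or.inr rfl) (fun _ => Or.inr rfl) monotone_const monotone_const fun _ => le_rfl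

/-- 𝒯 is symmetric. [this work] -/
theorem TensorKahn.symm (hT : TensorKahn X₂ w₂ g₂ h₂) : TensorKahn X₂ w₂ h₂ g₂ :=
  fun X₁ _ _ w₁ g₁ h₁ hw₁ hX₁ hg₁ hh₁ hg₁m hh₁m hK => (hT X₁ w₁ h₁ g₁ hw₁ hX₁ hh₁ hg₁ hh₁m hg₁m hK.symm).symm

/-! ## Closure under tensor products -/

section Assoc
variable {X₁ : Type u} [Fintype X₁] [Preorder X₁] {X₃ : Type u} [Fintype X₃] [Preorder X₃]

omit [Fintype X₁] [Fintype X₂] [Fintype X₃] in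
/-- Reassociating the product weight along `OrderIso.prodAssoc`. [this work] -/
theorem prodW_assoc (w₁ : X₁ → ℝ) (w₂ : X₂ → ℝ) (w₃ : X₃ → ℝ) :
    (prodW (prodW w₁ w₂) w₃) ∘ (OrderIso.prodAssoc X₁ X₂ X₃).symm = prodW w₁ (prodW w₂ w₃) := by
  funext z; obtain ⟨x₁, x₂, x₃⟩ := z
  simp only [Function.comp_apply, prodW]
  rw [show (OrderIso.prodAssoc X₁ X₂ X₃).symm (x₁, x₂, x₃) = ((x₁, x₂), x₃) from rfl]; ring

omit [Fintype X₁] [Fintype X₂] [Fintype X₃] in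
/-- Reassociating a triple tensor of functions along `OrderIso.prodAssoc`. [this work] -/
theorem lift_assoc (g₁ : X₁ → ℝ) (g₂ : X₂ → ℝ) (g₃ : X₃ → ℝ) :
    (liftX (liftX g₁ * liftY g₂) * liftY g₃ : (X₁ × X₂) × X₃ → ℝ) ∘ (OrderIso.prodAssoc X₁ X₂ X₃).symm =
      (liftX g₁ * liftY (liftX g₂ * liftY g₃) : X₁ × (X₂ × X₃) → ℝ) := by
  funext z; obtain ⟨x₁, x₂, x₃⟩ := z
  simp only [Function.comp_apply, Pi.mul_apply, liftX, liftY]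
  rw [show (OrderIso.prodAssoc X₁ X₂ X₃).symm (x₁, x₂, x₃) = ((x₁, x₂), x₃) from rfl]; ring

/-- **𝒯 is closed under tensor products**: if `(g₂,h₂)` on `X₂` and `(g₃,h₃)` on `X₃` tensor well, so does
`(g₂⊗g₃, h₂⊗h₃)` on `X₂ × X₃` (apply the two hypotheses in turn and reassociate). [this work] -/
theorem TensorKahn.tensor {w₃ g₃ h₃ : X₃ → ℝ} (hT₂ : TensorKahn X₂ w₂ g₂ h₂) (hT₃ : TensorKahn X₃ w₃ g₃ h₃)
    (hw₂ : IsProbWeight w₂) (hH₂ : IsHarris w₂) (hg₂ : IsIndicator g₂) (hh₂ : IsIndicator h₂) (hg₂m : Monotone g₂)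
    (hh₂m : Monotone h₂) :
    TensorKahn (X₂ × X₃) (prodW w₂ w₃) (liftX g₂ * liftY g₃) (liftX h₂ * liftY h₃) := by
  intro X₁ _ _ w₁ g₁ h₁ hw₁ hX₁ hg₁ hh₁ hg₁m hh₁m hK
  have K12 := hT₂ X₁ w₁ g₁ h₁ hw₁ hX₁ hg₁ hh₁ hg₁m hh₁m hK
  have K123 := hT₃ (X₁ × X₂) (prodW w₁ w₂) (liftX g₁ * liftY g₂) (liftX h₁ * liftY h₂) (isProbWeight_prodW hw₁ hw₂)
    (isHarris_prodW hw₁ hw₂ hX₁ hH₂) ((isIndicator_liftX hg₁).mul (isIndicator_liftY hg₂))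
    ((isIndicator_liftX hh₁).mul (isIndicator_liftY hh₂))
    ((monotone_liftX hg₁m).mul (monotone_liftY hg₂m) (fun z => hg₁.nonneg z.1) fun z => hg₂.nonneg z.2)
    ((monotone_liftX hh₁m).mul (monotone_liftY hh₂m) (fun z => hh₁.nonneg z.1) fun z => hh₂.nonneg z.2) K12
  have T := kahnPair_comp_orderIso (OrderIso.prodAssoc X₁ X₂ X₃).symm K123
  rwa [prodW_assoc, lift_assoc, lift_assoc] at T

end Assoc

/-! ## Closure under the AND-type module steps (all tensor products with nested pairs on the fresh block) -/

section Module
variable {Y : Type u} [Fintype Y] [Preorder Y] {w' v : Y → ℝ}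

/-- Adding a dummy Harris block: `(g₂⊗1, h₂⊗1)` tensors well if `(g₂,h₂)` does. [this work] -/
theorem TensorKahn.lift (hT : TensorKahn X₂ w₂ g₂ h₂) (hw₂ : IsProbWeight w₂) (hH₂ : IsHarris w₂) (hg₂ : IsIndicator g₂)
    (hh₂ : IsIndicator h₂) (hg₂m : Monotone g₂) (hh₂m : Monotone h₂) (hw' : IsProbWeight w') (hY : IsHarris w') :
    TensorKahn (X₂ × Y) (prodW w₂ w') (liftX g₂) (liftX h₂) := by
  have T := hT.tensor (tensorKahn_one_one hw' hY) hw₂ hH₂ hg₂ hh₂ hg₂m hh₂m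
  have e1 : (liftX g₂ * liftY (1 : Y → ℝ) : X₂ × Y → ℝ) = liftX g₂ := by funext z; simp [liftX, liftY]
  have e2 : (liftX h₂ * liftY (1 : Y → ℝ) : X₂ × Y → ℝ) = liftX h₂ := by funext z; simp [liftX, liftY]
  rwa [e1, e2] at T

/-- `(g₂ ∧ v, h₂)` tensors well if `(g₂,h₂)` does (`v` a monotone indicator on a fresh Harris block). [this work] -/
theorem TensorKahn.and_left (hT : TensorKahn X₂ w₂ g₂ h₂) (hw₂ : IsProbWeight w₂) (hH₂ : IsHarris w₂) (hg₂ : IsIndicator g₂)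
    (hh₂ : IsIndicator h₂) (hg₂m : Monotone g₂) (hh₂m : Monotone h₂) (hw' : IsProbWeight w') (hY : IsHarris w')
    (hv : IsIndicator v) (hvm : Monotone v) :
    TensorKahn (X₂ × Y) (prodW w₂ w') (liftX g₂ * liftY v) (liftX h₂) := by
  have h1 : IsIndicator (1 : Y → ℝ) := fun _ => Or.inr rfl
  have T := hT.tensor (tensorKahn_of_le (g₂ := v) (h₂ := (1 : Y → ℝ)) hw' hY hv h1 hvm monotone_const hv.le_one)
    hw₂ hH₂ hg₂ hh₂ hg₂m hh₂m
  have e2 : (liftX h₂ * liftY (1 : Y → ℝ) : X₂ × Y → ℝ) = liftX h₂ := by funext z; simp [liftX, liftY]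
  rwa [e2] at T

/-- `(g₂, h₂ ∧ v)` tensors well if `(g₂,h₂)` does. [this work] -/
theorem TensorKahn.and_right (hT : TensorKahn X₂ w₂ g₂ h₂) (hw₂ : IsProbWeight w₂) (hH₂ : IsHarris w₂) (hg₂ : IsIndicator g₂)
    (hh₂ : IsIndicator h₂) (hg₂m : Monotone g₂) (hh₂m : Monotone h₂) (hw' : IsProbWeight w') (hY : IsHarris w')
    (hv : IsIndicator v) (hvm : Monotone v) :
    TensorKahn (X₂ × Y) (prodW w₂ w') (liftX g₂) (liftX h₂ * liftY v) :=
  (hT.symm.and_left hw₂ hH₂ hh₂ hg₂ hh₂m hg₂m hw' hY hv hvm).symm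

/-- `(g₂ ∧ v, h₂ ∧ v)` tensors well if `(g₂,h₂)` does. [this work] -/
theorem TensorKahn.and_and (hT : TensorKahn X₂ w₂ g₂ h₂) (hw₂ : IsProbWeight w₂) (hH₂ : IsHarris w₂) (hg₂ : IsIndicator g₂)
    (hh₂ : IsIndicator h₂) (hg₂m : Monotone g₂) (hh₂m : Monotone h₂) (hw' : IsProbWeight w') (hY : IsHarris w')
    (hv : IsIndicator v) (hvm : Monotone v) :
    TensorKahn (X₂ × Y) (prodW w₂ w') (liftX g₂ * liftY v) (liftX h₂ * liftY v) :=
  hT.tensor (tensorKahn_of_le hw' hY hv hv hvm hvm fun _ => le_rfl) hw₂ hH₂ hg₂ hh₂ hg₂m hh₂m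

/-- `(g₂ ∧ v, h₂ ∨ v)` tensors well for ANY monotone indicators `g₂, h₂` (the pair is nested on `X₂ × Y`). [this work] -/
theorem tensorKahn_and_or (hw₂ : IsProbWeight w₂) (hH₂ : IsHarris w₂) (hg₂ : IsIndicator g₂) (hh₂ : IsIndicator h₂)
    (hg₂m : Monotone g₂) (hh₂m : Monotone h₂) (hw' : IsProbWeight w') (hY : IsHarris w') (hv : IsIndicator v)
    (hvm : Monotone v) : TensorKahn (X₂ × Y) (prodW w₂ w') (liftX g₂ * liftY v) (bor h₂ v) :=
  tensorKahn_of_le (isProbWeight_prodW hw₂ hw') (isHarris_prodW hw₂ hw' hH₂ hY) ((isIndicator_liftX hg₂).mul (isIndicator_liftY hv))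
    (isIndicator_bor hh₂ hv) ((monotone_liftX hg₂m).mul (monotone_liftY hvm) (fun z => hg₂.nonneg z.1) fun z => hv.nonneg z.2)
    (monotone_bor hh₂ hv hh₂m hvm) (liftX_mul_liftY_le_bor hg₂ hh₂ hv)

end Module

/-! ## Consequences for three blocks -/

/-- **Three blocks.**  A Kahn pair `(g₁,h₁)` on `X₁` tensored with two pairs that tensor well stays a Kahn pair:
`(g₁⊗g₂⊗g₃, h₁⊗h₂⊗h₃)` on `X₁ × (X₂ × X₃)`. [this work] -/
theorem kahnPair_tensor₃ {X₁ : Type u} [Fintype X₁] [Preorder X₁] {X₃ : Type u} [Fintype X₃] [Preorder X₃]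
    {w₁ g₁ h₁ : X₁ → ℝ} {w₃ g₃ h₃ : X₃ → ℝ} (hT₂ : TensorKahn X₂ w₂ g₂ h₂) (hT₃ : TensorKahn X₃ w₃ g₃ h₃)
    (hw₂ : IsProbWeight w₂) (hH₂ : IsHarris w₂) (hg₂ : IsIndicator g₂) (hh₂ : IsIndicator h₂) (hg₂m : Monotone g₂)
    (hh₂m : Monotone h₂) (hw₁ : IsProbWeight w₁) (hX₁ : IsHarris w₁) (hg₁ : IsIndicator g₁) (hh₁ : IsIndicator h₁)
    (hg₁m : Monotone g₁) (hh₁m : Monotone h₁) (hK : KahnPair w₁ g₁ h₁) :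
    KahnPair (prodW w₁ (prodW w₂ w₃)) (liftX g₁ * liftY (liftX g₂ * liftY g₃)) (liftX h₁ * liftY (liftX h₂ * liftY h₃)) :=
  (hT₂.tensor hT₃ hw₂ hH₂ hg₂ hh₂ hg₂m hh₂m) X₁ w₁ g₁ h₁ hw₁ hX₁ hg₁ hh₁ hg₁m hh₁m hK

/-- **Example** (new family): for a Kahn pair `(B,C)` on `X₁`, nested `U ⊆ U'` on a fresh Harris block `X₂` and nested `W' ⊆ W` on
another fresh Harris block `X₃`, the pair `(B ∧ U ∧ W, C ∧ U' ∧ W')` is a Kahn pair. [this work] -/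
theorem kahnPair_tensor_nested_nested {X₁ : Type u} [Fintype X₁] [Preorder X₁] {X₃ : Type u} [Fintype X₃] [Preorder X₃]
    {w₁ g₁ h₁ : X₁ → ℝ} {w₃ g₃ h₃ : X₃ → ℝ} (hw₁ : IsProbWeight w₁) (hX₁ : IsHarris w₁) (hg₁ : IsIndicator g₁)
    (hh₁ : IsIndicator h₁) (hg₁m : Monotone g₁) (hh₁m : Monotone h₁) (hK : KahnPair w₁ g₁ h₁)
    (hw₂ : IsProbWeight w₂) (hH₂ : IsHarris w₂) (hg₂ : IsIndicator g₂) (hh₂ : IsIndicator h₂) (hg₂m : Monotone g₂)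
    (hh₂m : Monotone h₂) (hle₂ : ∀ y, g₂ y ≤ h₂ y)
    (hw₃ : IsProbWeight w₃) (hH₃ : IsHarris w₃) (hg₃ : IsIndicator g₃) (hh₃ : IsIndicator h₃) (hg₃m : Monotone g₃)
    (hh₃m : Monotone h₃) (hge₃ : ∀ y, h₃ y ≤ g₃ y) :
    KahnPair (prodW w₁ (prodW w₂ w₃)) (liftX g₁ * liftY (liftX g₂ * liftY g₃)) (liftX h₁ * liftY (liftX h₂ * liftY h₃)) :=
  kahnPair_tensor₃ (tensorKahn_of_le hw₂ hH₂ hg₂ hh₂ hg₂m hh₂m hle₂) (tensorKahn_of_ge hw₃ hH₃ hg₃ hh₃ hg₃m hh₃m hge₃)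
    hw₂ hH₂ hg₂ hh₂ hg₂m hh₂m hw₁ hX₁ hg₁ hh₁ hg₁m hh₁m hK

end Summit.CriticalPhenomena.PercolationContinuityZ3.Theorems.SahiKahnModule
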